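import Literature.MathematicalPhysics.QuantumFieldTheory.Balaban1983to89.B15Prop1Thm1RowsOfExistsUnique
import Literature.MathematicalPhysics.QuantumFieldTheory.Balaban1983to89.Node00.Record12BgRowCoClassCPMFloor
import Summits.QuantumFields.YangMills.Theorems.BalabanUVNodesN07Thm1Top7FromProp8Guarded
import Summits.QuantumFields.YangMills.Theorems.BalabanUVNodesK0V22ZDefs
import HarnessLib

/-!
# BalabanUVNodes ∕ N12 — THE TWO [15]-THEOREM-1 LETTERS OF N12's (J0′) ROW, AT THE INSTANCE's LENGTH, FROM THE K0 ROAD's GRID-GUARDED TOKENS BY NAME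
# ([Balaban1985Variational] (1) p.277, Thm 1 (2)–(8) pp.278–279, Prop. 8 p.304; [Balaban1988Convergent] (2.1) p.254, (2.5) p.255, (2.12)–(2.13) p.256, (2.18) p.257;
# [Balaban1985RegularSpaces] (1.3)–(1.9) p.77; [Balaban1987RG1] (0.1) p.251; [Balaban1989LargeFieldI] (1.74) p.192, p.193 ll.14–20, Prop. 1 p.194)

Cell `pub-ymgap` (HUMAN RULINGS D-0062 ∕ D-0149), seat `pub-ymgap-dag-n12-d` g26 (R134 N12 [B15] s2 = by-name knit at the record; count-neutral helper of K1⁹ `stmt-QuantumFields-27364`,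
`--kind proof --supports … --as helper`).  THEOREMS ONLY (0 `def`, 0 `instance`, 0 `sorry`); compositions BY NAME.

WHAT.  N12's (J0′) row (the junction family `…N12MinimiserFamilyKnitRow*`) displays two [15]-Theorem-1 letters over NODE 00's torus class at `(ν, Kt)`: the (8)-letter `h15T` and the
existence ∕ uniqueness letter `h15EUT`.  The at-length editions (`B15Prop1Thm1RowsOfExistsUniqueAtLength`, `…KnitRowThm1LettersAtLengthOnZ(OfRecord)`) read them AT THE INSTANCE's
OWN LENGTH `k`.  THIS FILE serves both at-length letters from sentences in NODE 00's HOUSE SHAPE under an ARBITRARY prefix guard `Adm : Node00.StepGuard F` (K0⁷'s guard-generic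
currency, module 49 §4 `Node00.VariationalThm1RegSepCoP7MG`), read along the DEGENERATE HISTORY `(M, g) := (ν.M₁, 1)` where NODE 00's (2.18) class of record IS the torus class
(`B15Prop1Thm1RowsOfExistsUnique.DOfRecord_at_flat`; dag-n12-c's `exists_seq_reindex_Ω` ∕ `seqSeparated_iff_of_Ω_eq` move any torus-class index into it — the device of this seat's g14
`thm1TorusClass_of_variationalThm1RegSepCoP7M`, now WITH the guard threaded as ONE displayed row `hadm` «the guard holds at this instance's degenerate prefix»), and then AT THE K0 ROAD's
REGISTERED GUARD — the four-conjunct grid guard `A‴(c, c₀, c₁)` of K0⁷'s skeleton V22-Z (`K0V22ZDefs.Prop8StepCoPGridGAt`, text verbatim): there `hadm` IS the three numerics rows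
`c ≤ ν.M₁`, `k + c₀ ≤ m + K`, `L^{c₁} ∣ ν.M₁` plus the instance's own divisibility row `LᵏM₁ ∣ sitesPerDir 0` (the fourth conjunct at `g ≡ 1`: `R_i(1) = 1`, `dCubeSide L M₁ 1 i = LⁱM₁ ∣ LᵏM₁`).
§3 reads the (8)-letter straight off K0⁷'s REGISTERED STUB-1 TEXT `K0V22ZDefs.Prop8StepCoPGridGAt F` ([15] Prop. 8's grid-guarded top step; dag-n07-e's
`variationalThm1RegSepCoP7MG_of_prop8TopStepG`): the constants `(c, c₀, c₁, B₃, a₀, a₁)` are the stub's ∃-output.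

CONTENTS.  §1 (8): `thm1LetterT_atLength_of_variationalThm1RegSepCoP7MG` (generic guard) · `…_grid` (K0⁷'s grid guard, rows displayed) · §2 (E∕U): `thm1LetterEU_atLength_of_houseEUG`
(generic guard; the house-shape (E∕U) sentence = the lane's `thm1TorusClassEU_pos_of_thm1RecordEU_pos` hypothesis with ONE more antecedent `Adm …`, the shape a NODE 00 def would have)
· `…_grid` · §3 ★★ `exists_thm1LetterT_atLength_of_prop8StepCoPGridGAt` (from the registered stub-1 text by name).

HONEST FRAMING ∕ LOCATED.  Pure bookkeeping: the K0 tokens and the (E∕U) sentence are HYPOTHESES, never asserted here; K0⁷'s stub 1 is OPEN (N07's Prop. 8 road); the (E∕U) sentence has NO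
producer in the tree under any guard (orphan edge N07→N12; NODE 00 totalises the minimiser, so only N12 consumes it); reading a guard-generic sentence at the degenerate history `g ≡ 1`
is an instance of its typed generality (print's Thm 1 [15] is uniform in the admissible sequence), displayed, not hidden.  Nothing of Bałaban's asserted; N12 NOT discharged; K0⁷ ∕ K1⁹
NOT closed; counts unmoved (typed 28∕28 · discharged 8∕27, A 8∕28); R4 closes only the conditional finite-𝕋⁴ rung `BalabanLadder.UV`; no summit statement is proved here and NOT the
Yang–Mills mass gap (Clay); nothing continuum ∕ ℝ⁴ ∕ OS.
-/

noncomputable section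

namespace Summit.QuantumFields.YangMills.BalabanUVNodes.N12Thm1LettersAtLengthOfK0GridG

open scoped Matrix.Norms.L2Operator
open Literature.MathematicalPhysics.QuantumFieldTheory.Balaban1983to89
open T4Continuum B15DeterminingSets GaugeField B15Prop1Carrier
open B16Sect1Backgrounds (toMS)
open B14.Eq213MaximalDomains (side)
open T4CubeChartGnomonic (SU2)
open B15Prop1Thm1GeneralFormShapes (exists_seq_reindex_Ω seqSeparated_iff_of_Ω_eq)
open B15Prop1Thm1RowsOfExistsUnique (DOfRecord_at_flat RkOfRecord_at_flat)
open Node00 (StepGuard SeqOfRecord Stage7Numerics VariationalThm1RegSepCoP7MG dCubeSide RkOfRecord suppDomOfRecord Prop8RegSepTopStepG)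
open Summit.QuantumFields.YangMills.BalabanUVNodes.N07Thm1Top7FromProp8 (variationalThm1RegSepCoP7MG_of_prop8TopStepG)
open Summit.QuantumFields.YangMills.Theorems.K0V22ZDefs (Prop8StepCoPGridGAt)

variable {F : T4Family}

/-! ## §1  The (8)-letter at the instance's length from the guard-generic (8)-sentence in NODE 00's house -/

/-- ★ **THE (8)-LETTER OF N12's (J0′) ROW AT LENGTH `k`, FROM K0's GUARD-GENERIC (8)-SENTENCE** `Node00.VariationalThm1RegSepCoP7MG F 2 Adm B₃ a₀ a₁` ([15] Thm 1 (R) for minimisers over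
class (6) on the support of record, every numerics ∕ cube letter ∕ coupling history ∕ torus ∕ length ∕ separated (2.18) index of record PASSING THE PREFIX GUARD `Adm`), READ ALONG THE
DEGENERATE HISTORY `(M, g) := (ν.M₁, 1)` at torus `Kt` and length `k`: there NODE 00's class of record IS the torus class of `LʲM₁`-cube unions (`DOfRecord_at_flat`), every torus-class
index re-indexes into it along its `Ω`-sequence (`exists_seq_reindex_Ω`; every reader of the body reads `s.Ω` only), and the guard is asked ONCE as the displayed row `hadm` «`Adm` holds at
every index of record of the prefix `(ν, ν.M₁, 1, Kt, k)`».  Conclusion = the `h15T` letter of `B15Prop1Thm1RowsOfExistsUniqueAtLength` at `k i := k`, VERBATIM.  Pure bookkeeping; the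
sentence stays a HYPOTHESIS. [cite: Balaban1985Variational, (1) p.277, Thm 1 (2),(3),(5),(6),(7)–(8) pp.278–279, p.304 lines 1–2; Balaban1988Convergent, (2.1) p.254, (2.5) p.255, (2.12)–(2.13) p.256, (2.18) p.257; Balaban1985RegularSpaces, (1.3)–(1.9) p.77; Balaban1987RG1, (0.1) p.251 (bookkeeping)] -/
theorem thm1LetterT_atLength_of_variationalThm1RegSepCoP7MG {Adm : StepGuard F} {B₃ a₀ a₁ : ℝ} (h15 : VariationalThm1RegSepCoP7MG F 2 Adm B₃ a₀ a₁)
    (ν : Stage7Numerics) (Kt k : ℕ) (hadm : ∀ s₁ : SeqOfRecord F ν ν.M₁ (fun _ => (1 : ℝ)) Kt k, Adm ν ν.M₁ (fun _ => (1 : ℝ)) Kt k s₁) :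
    ∀ (s : B14.Eq218Concrete.Seq (fun n : ℕ => Node00.unionsOfCubes (F.P Kt) (side (F.P Kt).L ν.M₁ n)) k),
      Node00.Sect2.SeqSeparated ν.M₁ s → 0 < ν.M₁ →
      ∀ (ε₀ : ℝ) (δ : ℕ → ℝ), (∀ j, j ≤ k → 0 < δ j ∧ δ j ≤ a₁ ∧ B₃ * δ j ≤ ε₀) → (∀ j, j < k → δ j ≤ 2 * δ (j + 1)) →
      (∀ j, j < k → δ (j + 1) ≤ 2 * δ j) → ε₀ ≤ a₀ →
      ∀ W : MSField (F.P Kt) SU2,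
        Node00.Sect2.DataSmall7PTop (Node00.avOfRecord F 2 Kt) s.Ω (Node00.suppDomOfRecord F ν Kt s.Ω) k δ W →
        ∀ U₀ : GaugeField (F.P Kt) 0 SU2, IsMinimizer (Node00.avOfRecord F 2 Kt)
            {U | (∀ j, j ≤ k → PlaqSmallOn (Node00.Sect2.omegaPlaqsTop s.Ω (Node00.suppDomOfRecord F ν Kt s.Ω) j)
                (ε₀ * (F.P Kt).eta j ^ 2) U) ∧
              Node00.Sect2.CoDivClassOnTop s.Ω (Node00.suppDomOfRecord F ν Kt s.Ω) k ε₀ U}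
            (genSet s.Ω k) W U₀ →
          (∀ j, j ≤ k → PlaqSmallOn (Node00.Sect2.omegaPlaqsTop s.Ω (Node00.suppDomOfRecord F ν Kt s.Ω) j)
              (B₃ * δ j * (F.P Kt).eta j ^ 2) U₀) ∧
            ∀ j, j ≤ k → Node00.Sect2.CoDivSmallOn (Node00.Sect2.omegaBondsTop s.Ω (Node00.suppDomOfRecord F ν Kt s.Ω) j)
              (B₃ * δ j * (F.P Kt).eta j ^ 3) U₀ := by
  intro s hsep hM₁
  obtain ⟨s', hΩ, -⟩ := exists_seq_reindex_Ω s (Node00.DOfRecord F ν ν.M₁ (fun _ => (1 : ℝ)) Kt) fun j h1 hj => by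
    rw [DOfRecord_at_flat]; exact s.chain.memΩ j h1 hj
  have h := h15 ν ν.M₁ (fun _ => (1 : ℝ)) Kt k s' ((seqSeparated_iff_of_Ω_eq ν.M₁ hΩ).2 hsep) hM₁ (hadm s')
  rw [hΩ] at h
  exact h

/-- ★ **THE SAME AT THE K0 ROAD's REGISTERED GUARD** — K0⁷ V22-Z's four-conjunct grid guard `A‴(c, c₀, c₁)` (the `Adm` of `K0V22ZDefs.Prop8StepCoPGridGAt` ∕ of stub 3ᴬ′-G‴-Z's
antecedent, text VERBATIM): the row `hadm` IS the numerics floor `c ≤ ν.M₁`, the level guard `k + c₀ ≤ m + Kt`, the granularity `L^{c₁} ∣ ν.M₁`, and — for the fourth conjunct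
(torus-compatibility of the `𝐃_i`-partitions, `1 ≤ i ≤ k`) — the instance's own divisibility row `LᵏM₁ ∣ sitesPerDir 0`: along `g ≡ 1` the (2.5) factor is `R_i(1) = 1`
(`RkOfRecord_at_flat`) and `dCubeSide L M₁ 1 i = LⁱM₁` divides `LᵏM₁`. [cite: Balaban1985Variational, Thm 1 (8) p.279, p.304 lines 1–2; Balaban1985RegularSpaces, (1.3)–(1.6) p.77; Balaban1988Convergent, (2.1) p.254, (2.5) p.255, (2.17)–(2.18) p.257; Balaban1987RG1, (0.1) p.251 (bookkeeping)] -/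
theorem thm1LetterT_atLength_of_variationalThm1RegSepCoP7MG_grid {c c₀ c₁ : ℕ} {B₃ a₀ a₁ : ℝ}
    (h15 : VariationalThm1RegSepCoP7MG F 2
      (fun ν M g K k _s => c ≤ ν.M₁ ∧ k + c₀ ≤ F.m + K ∧ F.L ^ c₁ ∣ M ∧
        ∀ i, 1 ≤ i → i ≤ k → dCubeSide (F.P K).L M (RkOfRecord (F.P K).L ν.r (g i)) i ∣ (F.P K).sitesPerDir 0) B₃ a₀ a₁)
    (ν : Stage7Numerics) (Kt k : ℕ) (hc : c ≤ ν.M₁) (hkc₀ : k + c₀ ≤ F.m + Kt) (hc₁ : F.L ^ c₁ ∣ ν.M₁)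
    (hdiv : side (F.P Kt).L ν.M₁ k ∣ (F.P Kt).sitesPerDir 0) :
    ∀ (s : B14.Eq218Concrete.Seq (fun n : ℕ => Node00.unionsOfCubes (F.P Kt) (side (F.P Kt).L ν.M₁ n)) k),
      Node00.Sect2.SeqSeparated ν.M₁ s → 0 < ν.M₁ →
      ∀ (ε₀ : ℝ) (δ : ℕ → ℝ), (∀ j, j ≤ k → 0 < δ j ∧ δ j ≤ a₁ ∧ B₃ * δ j ≤ ε₀) → (∀ j, j < k → δ j ≤ 2 * δ (j + 1)) →
      (∀ j, j < k → δ (j + 1) ≤ 2 * δ j) → ε₀ ≤ a₀ →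
      ∀ W : MSField (F.P Kt) SU2,
        Node00.Sect2.DataSmall7PTop (Node00.avOfRecord F 2 Kt) s.Ω (Node00.suppDomOfRecord F ν Kt s.Ω) k δ W →
        ∀ U₀ : GaugeField (F.P Kt) 0 SU2, IsMinimizer (Node00.avOfRecord F 2 Kt)
            {U | (∀ j, j ≤ k → PlaqSmallOn (Node00.Sect2.omegaPlaqsTop s.Ω (Node00.suppDomOfRecord F ν Kt s.Ω) j)
                (ε₀ * (F.P Kt).eta j ^ 2) U) ∧
              Node00.Sect2.CoDivClassOnTop s.Ω (Node00.suppDomOfRecord F ν Kt s.Ω) k ε₀ U}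
            (genSet s.Ω k) W U₀ →
          (∀ j, j ≤ k → PlaqSmallOn (Node00.Sect2.omegaPlaqsTop s.Ω (Node00.suppDomOfRecord F ν Kt s.Ω) j)
              (B₃ * δ j * (F.P Kt).eta j ^ 2) U₀) ∧
            ∀ j, j ≤ k → Node00.Sect2.CoDivSmallOn (Node00.Sect2.omegaBondsTop s.Ω (Node00.suppDomOfRecord F ν Kt s.Ω) j)
              (B₃ * δ j * (F.P Kt).eta j ^ 3) U₀ :=
  thm1LetterT_atLength_of_variationalThm1RegSepCoP7MG h15 ν Kt k fun _ => ⟨hc, hkc₀, hc₁, fun i _ hi => by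
    show dCubeSide (F.P Kt).L ν.M₁ (RkOfRecord (F.P Kt).L ν.r 1) i ∣ (F.P Kt).sitesPerDir 0
    rw [RkOfRecord_at_flat]
    refine Dvd.dvd.trans ?_ hdiv
    show (F.P Kt).L ^ i * ν.M₁ * 1 ∣ (F.P Kt).L ^ k * ν.M₁
    rw [Nat.mul_one]
    exact Nat.mul_dvd_mul_right (pow_dvd_pow _ hi) _⟩

/-! ## §2  The existence ∕ uniqueness letter at the instance's length from a guard-generic (E∕U)-sentence in NODE 00's house -/

/-- ★ **THE (E∕U)-LETTER OF N12's (J0′) ROW AT LENGTH `k ≥ 1`, FROM A GUARD-GENERIC (E∕U)-SENTENCE IN NODE 00's HOUSE SHAPE** — the hypothesis `h15EU` of the lane's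
`B15Prop1Thm1RowsOfExistsUniquePos.thm1TorusClassEU_pos_of_thm1RecordEU_pos` (binders = `Node00.VariationalThm1RegSepCoP7M`'s + `0 < k'`; conclusion «∃ minimiser over class (6) at `ε₀`»
∧ «any two minimisers differ by a gauge with equal, central scale-`j` images at the two ends of every constrained bond») with ONE MORE ANTECEDENT `Adm ν' M g K k' s` — the guard-generic
shape a NODE 00 def twin of `VariationalThm1RegSepCoP7MG` would have (node00-def's pen; NOT defined here; NO producer in the tree) — READ ALONG THE DEGENERATE HISTORY at `(ν, Kt, k)` with
the guard row `hadm`.  Conclusion = the `h15EUT` letter of `B15Prop1Thm1RowsOfExistsUniqueAtLength` at `k i := k`, VERBATIM. [cite: Balaban1985Variational, (1) p.277, Thm 1 (2),(3),(4),(5),(6),(7) pp.278–279, p.278 lines 19–20; Balaban1988Convergent, (2.1) p.254, (2.5) p.255, (2.12)–(2.13) p.256, (2.18) p.257; Balaban1985RegularSpaces, (1.3)–(1.9) p.77 (bookkeeping)] -/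
theorem thm1LetterEU_atLength_of_houseEUG {Adm : StepGuard F} {B₃ a₀ a₁ : ℝ}
    (hEU : ∀ (ν' : Stage7Numerics) (M : ℕ) (g : ℕ → ℝ) (K k' : ℕ) (s : SeqOfRecord F ν' M g K k'), 0 < k' →
      Node00.Sect2.SeqSeparated ν'.M₁ s → 0 < ν'.M₁ → Adm ν' M g K k' s →
      ∀ (ε₀ : ℝ) (δ : ℕ → ℝ), (∀ j, j ≤ k' → 0 < δ j ∧ δ j ≤ a₁ ∧ B₃ * δ j ≤ ε₀) → (∀ j, j < k' → δ j ≤ 2 * δ (j + 1)) →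
      (∀ j, j < k' → δ (j + 1) ≤ 2 * δ j) → ε₀ ≤ a₀ →
      ∀ W : MSField (F.P K) SU2,
        Node00.Sect2.DataSmall7PTop (Node00.avOfRecord F 2 K) s.Ω (Node00.suppDomOfRecord F ν' K s.Ω) k' δ W →
        (∃ U₀ : GaugeField (F.P K) 0 SU2, IsMinimizer (Node00.avOfRecord F 2 K)
            {U | (∀ j, j ≤ k' → PlaqSmallOn (Node00.Sect2.omegaPlaqsTop s.Ω (Node00.suppDomOfRecord F ν' K s.Ω) j)
                (ε₀ * (F.P K).eta j ^ 2) U) ∧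
              Node00.Sect2.CoDivClassOnTop s.Ω (Node00.suppDomOfRecord F ν' K s.Ω) k' ε₀ U}
            (genSet s.Ω k') W U₀) ∧
        ∀ U₁ U₂ : GaugeField (F.P K) 0 SU2,
          IsMinimizer (Node00.avOfRecord F 2 K)
            {U | (∀ j, j ≤ k' → PlaqSmallOn (Node00.Sect2.omegaPlaqsTop s.Ω (Node00.suppDomOfRecord F ν' K s.Ω) j)
                (ε₀ * (F.P K).eta j ^ 2) U) ∧
              Node00.Sect2.CoDivClassOnTop s.Ω (Node00.suppDomOfRecord F ν' K s.Ω) k' ε₀ U}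
            (genSet s.Ω k') W U₁ →
          IsMinimizer (Node00.avOfRecord F 2 K)
            {U | (∀ j, j ≤ k' → PlaqSmallOn (Node00.Sect2.omegaPlaqsTop s.Ω (Node00.suppDomOfRecord F ν' K s.Ω) j)
                (ε₀ * (F.P K).eta j ^ 2) U) ∧
              Node00.Sect2.CoDivClassOnTop s.Ω (Node00.suppDomOfRecord F ν' K s.Ω) k' ε₀ U}
            (genSet s.Ω k') W U₂ →
          ∃ u : GaugeTransf (F.P K) 0 SU2,
            (∀ j, j ≤ k' → ∀ b ∈ bondsOf (genSet s.Ω k' j), toMS u j b.src = toMS u j b.tgt ∧ ∀ g : SU2, toMS u j b.src * g = g * toMS u j b.src) ∧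
              gaugeAct u U₁ = U₂)
    (ν : Stage7Numerics) (Kt k : ℕ) (hk0 : 0 < k) (hadm : ∀ s₁ : SeqOfRecord F ν ν.M₁ (fun _ => (1 : ℝ)) Kt k, Adm ν ν.M₁ (fun _ => (1 : ℝ)) Kt k s₁) :
    ∀ (s : B14.Eq218Concrete.Seq (fun n : ℕ => Node00.unionsOfCubes (F.P Kt) (side (F.P Kt).L ν.M₁ n)) k),
      Node00.Sect2.SeqSeparated ν.M₁ s → 0 < ν.M₁ →
      ∀ (ε₀ : ℝ) (δ : ℕ → ℝ), (∀ j, j ≤ k → 0 < δ j ∧ δ j ≤ a₁ ∧ B₃ * δ j ≤ ε₀) → (∀ j, j < k → δ j ≤ 2 * δ (j + 1)) →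
      (∀ j, j < k → δ (j + 1) ≤ 2 * δ j) → ε₀ ≤ a₀ →
      ∀ W : MSField (F.P Kt) SU2,
        Node00.Sect2.DataSmall7PTop (Node00.avOfRecord F 2 Kt) s.Ω (Node00.suppDomOfRecord F ν Kt s.Ω) k δ W →
        (∃ U₀ : GaugeField (F.P Kt) 0 SU2, IsMinimizer (Node00.avOfRecord F 2 Kt)
            {U | (∀ j, j ≤ k → PlaqSmallOn (Node00.Sect2.omegaPlaqsTop s.Ω (Node00.suppDomOfRecord F ν Kt s.Ω) j)
                (ε₀ * (F.P Kt).eta j ^ 2) U) ∧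
              Node00.Sect2.CoDivClassOnTop s.Ω (Node00.suppDomOfRecord F ν Kt s.Ω) k ε₀ U}
            (genSet s.Ω k) W U₀) ∧
        ∀ U₁ U₂ : GaugeField (F.P Kt) 0 SU2,
          IsMinimizer (Node00.avOfRecord F 2 Kt)
            {U | (∀ j, j ≤ k → PlaqSmallOn (Node00.Sect2.omegaPlaqsTop s.Ω (Node00.suppDomOfRecord F ν Kt s.Ω) j)
                (ε₀ * (F.P Kt).eta j ^ 2) U) ∧
              Node00.Sect2.CoDivClassOnTop s.Ω (Node00.suppDomOfRecord F ν Kt s.Ω) k ε₀ U}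
            (genSet s.Ω k) W U₁ →
          IsMinimizer (Node00.avOfRecord F 2 Kt)
            {U | (∀ j, j ≤ k → PlaqSmallOn (Node00.Sect2.omegaPlaqsTop s.Ω (Node00.suppDomOfRecord F ν Kt s.Ω) j)
                (ε₀ * (F.P Kt).eta j ^ 2) U) ∧
              Node00.Sect2.CoDivClassOnTop s.Ω (Node00.suppDomOfRecord F ν Kt s.Ω) k ε₀ U}
            (genSet s.Ω k) W U₂ →
          ∃ u : GaugeTransf (F.P Kt) 0 SU2,
            (∀ j, j ≤ k → ∀ b ∈ bondsOf (genSet s.Ω k j), toMS u j b.src = toMS u j b.tgt ∧ ∀ g : SU2, toMS u j b.src * g = g * toMS u j b.src) ∧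
              gaugeAct u U₁ = U₂ := by
  intro s hsep hM₁
  obtain ⟨s', hΩ, -⟩ := exists_seq_reindex_Ω s (Node00.DOfRecord F ν ν.M₁ (fun _ => (1 : ℝ)) Kt) fun j h1 hj => by
    rw [DOfRecord_at_flat]; exact s.chain.memΩ j h1 hj
  have h := hEU ν ν.M₁ (fun _ => (1 : ℝ)) Kt k s' hk0 ((seqSeparated_iff_of_Ω_eq ν.M₁ hΩ).2 hsep) hM₁ (hadm s')
  rw [hΩ] at h
  exact h

/-- ★ **THE SAME AT THE K0 ROAD's REGISTERED GUARD** `A‴(c, c₀, c₁)` (rows as in §1's `_grid`). [cite: Balaban1985Variational, Thm 1 (2)–(7) pp.278–279, p.304 lines 1–2; Balaban1985RegularSpaces, (1.3)–(1.6) p.77; Balaban1988Convergent, (2.1) p.254, (2.5) p.255, (2.18) p.257 (bookkeeping)] -/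
theorem thm1LetterEU_atLength_of_houseEUG_grid {c c₀ c₁ : ℕ} {B₃ a₀ a₁ : ℝ}
    (hEU : ∀ (ν' : Stage7Numerics) (M : ℕ) (g : ℕ → ℝ) (K k' : ℕ) (s : SeqOfRecord F ν' M g K k'), 0 < k' →
      Node00.Sect2.SeqSeparated ν'.M₁ s → 0 < ν'.M₁ →
      (c ≤ ν'.M₁ ∧ k' + c₀ ≤ F.m + K ∧ F.L ^ c₁ ∣ M ∧
        ∀ i, 1 ≤ i → i ≤ k' → dCubeSide (F.P K).L M (RkOfRecord (F.P K).L ν'.r (g i)) i ∣ (F.P K).sitesPerDir 0) →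
      ∀ (ε₀ : ℝ) (δ : ℕ → ℝ), (∀ j, j ≤ k' → 0 < δ j ∧ δ j ≤ a₁ ∧ B₃ * δ j ≤ ε₀) → (∀ j, j < k' → δ j ≤ 2 * δ (j + 1)) →
      (∀ j, j < k' → δ (j + 1) ≤ 2 * δ j) → ε₀ ≤ a₀ →
      ∀ W : MSField (F.P K) SU2,
        Node00.Sect2.DataSmall7PTop (Node00.avOfRecord F 2 K) s.Ω (Node00.suppDomOfRecord F ν' K s.Ω) k' δ W →
        (∃ U₀ : GaugeField (F.P K) 0 SU2, IsMinimizer (Node00.avOfRecord F 2 K)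
            {U | (∀ j, j ≤ k' → PlaqSmallOn (Node00.Sect2.omegaPlaqsTop s.Ω (Node00.suppDomOfRecord F ν' K s.Ω) j)
                (ε₀ * (F.P K).eta j ^ 2) U) ∧
              Node00.Sect2.CoDivClassOnTop s.Ω (Node00.suppDomOfRecord F ν' K s.Ω) k' ε₀ U}
            (genSet s.Ω k') W U₀) ∧
        ∀ U₁ U₂ : GaugeField (F.P K) 0 SU2,
          IsMinimizer (Node00.avOfRecord F 2 K)
            {U | (∀ j, j ≤ k' → PlaqSmallOn (Node00.Sect2.omegaPlaqsTop s.Ω (Node00.suppDomOfRecord F ν' K s.Ω) j)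
                (ε₀ * (F.P K).eta j ^ 2) U) ∧
              Node00.Sect2.CoDivClassOnTop s.Ω (Node00.suppDomOfRecord F ν' K s.Ω) k' ε₀ U}
            (genSet s.Ω k') W U₁ →
          IsMinimizer (Node00.avOfRecord F 2 K)
            {U | (∀ j, j ≤ k' → PlaqSmallOn (Node00.Sect2.omegaPlaqsTop s.Ω (Node00.suppDomOfRecord F ν' K s.Ω) j)
                (ε₀ * (F.P K).eta j ^ 2) U) ∧
              Node00.Sect2.CoDivClassOnTop s.Ω (Node00.suppDomOfRecord F ν' K s.Ω) k' ε₀ U}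
            (genSet s.Ω k') W U₂ →
          ∃ u : GaugeTransf (F.P K) 0 SU2,
            (∀ j, j ≤ k' → ∀ b ∈ bondsOf (genSet s.Ω k' j), toMS u j b.src = toMS u j b.tgt ∧ ∀ g : SU2, toMS u j b.src * g = g * toMS u j b.src) ∧
              gaugeAct u U₁ = U₂)
    (ν : Stage7Numerics) (Kt k : ℕ) (hk0 : 0 < k) (hc : c ≤ ν.M₁) (hkc₀ : k + c₀ ≤ F.m + Kt) (hc₁ : F.L ^ c₁ ∣ ν.M₁)
    (hdiv : side (F.P Kt).L ν.M₁ k ∣ (F.P Kt).sitesPerDir 0) :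
    ∀ (s : B14.Eq218Concrete.Seq (fun n : ℕ => Node00.unionsOfCubes (F.P Kt) (side (F.P Kt).L ν.M₁ n)) k),
      Node00.Sect2.SeqSeparated ν.M₁ s → 0 < ν.M₁ →
      ∀ (ε₀ : ℝ) (δ : ℕ → ℝ), (∀ j, j ≤ k → 0 < δ j ∧ δ j ≤ a₁ ∧ B₃ * δ j ≤ ε₀) → (∀ j, j < k → δ j ≤ 2 * δ (j + 1)) →
      (∀ j, j < k → δ (j + 1) ≤ 2 * δ j) → ε₀ ≤ a₀ →
      ∀ W : MSField (F.P Kt) SU2,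
        Node00.Sect2.DataSmall7PTop (Node00.avOfRecord F 2 Kt) s.Ω (Node00.suppDomOfRecord F ν Kt s.Ω) k δ W →
        (∃ U₀ : GaugeField (F.P Kt) 0 SU2, IsMinimizer (Node00.avOfRecord F 2 Kt)
            {U | (∀ j, j ≤ k → PlaqSmallOn (Node00.Sect2.omegaPlaqsTop s.Ω (Node00.suppDomOfRecord F ν Kt s.Ω) j)
                (ε₀ * (F.P Kt).eta j ^ 2) U) ∧
              Node00.Sect2.CoDivClassOnTop s.Ω (Node00.suppDomOfRecord F ν Kt s.Ω) k ε₀ U}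
            (genSet s.Ω k) W U₀) ∧
        ∀ U₁ U₂ : GaugeField (F.P Kt) 0 SU2,
          IsMinimizer (Node00.avOfRecord F 2 Kt)
            {U | (∀ j, j ≤ k → PlaqSmallOn (Node00.Sect2.omegaPlaqsTop s.Ω (Node00.suppDomOfRecord F ν Kt s.Ω) j)
                (ε₀ * (F.P Kt).eta j ^ 2) U) ∧
              Node00.Sect2.CoDivClassOnTop s.Ω (Node00.suppDomOfRecord F ν Kt s.Ω) k ε₀ U}
            (genSet s.Ω k) W U₁ →
          IsMinimizer (Node00.avOfRecord F 2 Kt)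
            {U | (∀ j, j ≤ k → PlaqSmallOn (Node00.Sect2.omegaPlaqsTop s.Ω (Node00.suppDomOfRecord F ν Kt s.Ω) j)
                (ε₀ * (F.P Kt).eta j ^ 2) U) ∧
              Node00.Sect2.CoDivClassOnTop s.Ω (Node00.suppDomOfRecord F ν Kt s.Ω) k ε₀ U}
            (genSet s.Ω k) W U₂ →
          ∃ u : GaugeTransf (F.P Kt) 0 SU2,
            (∀ j, j ≤ k → ∀ b ∈ bondsOf (genSet s.Ω k j), toMS u j b.src = toMS u j b.tgt ∧ ∀ g : SU2, toMS u j b.src * g = g * toMS u j b.src) ∧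
              gaugeAct u U₁ = U₂ :=
  thm1LetterEU_atLength_of_houseEUG
    (Adm := fun ν M g K k _s => c ≤ ν.M₁ ∧ k + c₀ ≤ F.m + K ∧ F.L ^ c₁ ∣ M ∧
      ∀ i, 1 ≤ i → i ≤ k → dCubeSide (F.P K).L M (RkOfRecord (F.P K).L ν.r (g i)) i ∣ (F.P K).sitesPerDir 0)
    hEU ν Kt k hk0 fun _ => ⟨hc, hkc₀, hc₁, fun i _ hi => by
      show dCubeSide (F.P Kt).L ν.M₁ (RkOfRecord (F.P Kt).L ν.r 1) i ∣ (F.P Kt).sitesPerDir 0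
      rw [RkOfRecord_at_flat]
      refine Dvd.dvd.trans ?_ hdiv
      show (F.P Kt).L ^ i * ν.M₁ * 1 ∣ (F.P Kt).L ^ k * ν.M₁
      rw [Nat.mul_one]
      exact Nat.mul_dvd_mul_right (pow_dvd_pow _ hi) _⟩

/-! ## §3  The (8)-letter straight off K0⁷'s REGISTERED stub-1 text -/

/-- ★★ **THE (8)-LETTER OF N12's (J0′) ROW FROM K0⁷'s REGISTERED STUB-1 TEXT BY NAME** — `K0V22ZDefs.Prop8StepCoPGridGAt F` (the tree copy, byte for byte, of skeleton V22-Z's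
`stub_prop8StepCoPGridG13 : ∀ F, Prop8StepCoPGridGAt F`: [15] Prop. 8's top step at NODE 00's support domains under the grid guard `A‴(c, c₀, c₁)`, constants ∃-bound): for the
stub's OWN constants `(c, c₀, c₁, B₃, a₀, a₁)` (`2L² ≤ B₃`, `0 < a₀`, `0 < a₁`), dag-n07-e's `variationalThm1RegSepCoP7MG_of_prop8TopStepG` (`0 < B₃`) gives the grid-guarded
(8)-sentence and §1's `_grid` the at-length letter at every `(ν, Kt, k)` passing the three numerics rows and the divisibility row.  CONDITIONAL on the stub text (K0⁷ OPEN); nothing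
asserted. [cite: Balaban1985Variational, Thm 1 (6)–(8) pp.278–279, Prop. 8 p.304, p.304 lines 1–2; Balaban1985RegularSpaces, (1.3)–(1.6) p.77; Balaban1988Convergent, (2.1) p.254, (2.5) p.255, (2.12) p.256, (2.17)–(2.18) p.257; Balaban1987RG1, (0.1) p.251] -/
theorem exists_thm1LetterT_atLength_of_prop8StepCoPGridGAt (h1 : Prop8StepCoPGridGAt F) :
    ∃ (c c₀ c₁ : ℕ) (B₃ a₀ a₁ : ℝ), 2 * (F.L : ℝ) ^ 2 ≤ B₃ ∧ 0 < a₀ ∧ 0 < a₁ ∧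
    ∀ (ν : Stage7Numerics) (Kt k : ℕ), c ≤ ν.M₁ → k + c₀ ≤ F.m + Kt → F.L ^ c₁ ∣ ν.M₁ → side (F.P Kt).L ν.M₁ k ∣ (F.P Kt).sitesPerDir 0 →
    ∀ (s : B14.Eq218Concrete.Seq (fun n : ℕ => Node00.unionsOfCubes (F.P Kt) (side (F.P Kt).L ν.M₁ n)) k),
      Node00.Sect2.SeqSeparated ν.M₁ s → 0 < ν.M₁ →
      ∀ (ε₀ : ℝ) (δ : ℕ → ℝ), (∀ j, j ≤ k → 0 < δ j ∧ δ j ≤ a₁ ∧ B₃ * δ j ≤ ε₀) → (∀ j, j < k → δ j ≤ 2 * δ (j + 1)) →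
      (∀ j, j < k → δ (j + 1) ≤ 2 * δ j) → ε₀ ≤ a₀ →
      ∀ W : MSField (F.P Kt) SU2,
        Node00.Sect2.DataSmall7PTop (Node00.avOfRecord F 2 Kt) s.Ω (Node00.suppDomOfRecord F ν Kt s.Ω) k δ W →
        ∀ U₀ : GaugeField (F.P Kt) 0 SU2, IsMinimizer (Node00.avOfRecord F 2 Kt)
            {U | (∀ j, j ≤ k → PlaqSmallOn (Node00.Sect2.omegaPlaqsTop s.Ω (Node00.suppDomOfRecord F ν Kt s.Ω) j)
                (ε₀ * (F.P Kt).eta j ^ 2) U) ∧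
              Node00.Sect2.CoDivClassOnTop s.Ω (Node00.suppDomOfRecord F ν Kt s.Ω) k ε₀ U}
            (genSet s.Ω k) W U₀ →
          (∀ j, j ≤ k → PlaqSmallOn (Node00.Sect2.omegaPlaqsTop s.Ω (Node00.suppDomOfRecord F ν Kt s.Ω) j)
              (B₃ * δ j * (F.P Kt).eta j ^ 2) U₀) ∧
            ∀ j, j ≤ k → Node00.Sect2.CoDivSmallOn (Node00.Sect2.omegaBondsTop s.Ω (Node00.suppDomOfRecord F ν Kt s.Ω) j)
              (B₃ * δ j * (F.P Kt).eta j ^ 3) U₀ := by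
  obtain ⟨c, c₀, c₁, B₃, a₀, a₁, hB₃, ha₀, ha₁, h8⟩ := h1
  have hL : (1 : ℝ) ≤ F.L := by exact_mod_cast F.hL.2.le
  have hB : 0 < B₃ := lt_of_lt_of_le (by positivity) hB₃
  exact ⟨c, c₀, c₁, B₃, a₀, a₁, hB₃, ha₀, ha₁, fun ν Kt k hc hkc₀ hc₁ hdiv =>
    thm1LetterT_atLength_of_variationalThm1RegSepCoP7MG_grid (variationalThm1RegSepCoP7MG_of_prop8TopStepG hB h8) ν Kt k hc hkc₀ hc₁ hdiv⟩

end Summit.QuantumFields.YangMills.BalabanUVNodes.N12Thm1LettersAtLengthOfK0GridG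

end
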